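import Literature.Probability.LatticeModels.DiluteLinkStates
import Literature.Probability.LatticeModels.DiluteA22Weights
import Literature.Probability.RandomPlanarGeometry.HexSAW
import Mathlib.Analysis.Calculus.Deriv.Basic
import Mathlib.Data.Matrix.Mul
import Mathlib.Tactic.DeriveFintype
import HarnessLib

/-!
# Dilute Temperley–Lieb tiles, the `A₂⁽²⁾` face operator, and the honeycomb `O(n)` vertex

Part 3 of the definition request `defn-HexONTransferMatrix` (routes `CriticalPhenomena/SAWScalingLimit/`
`SAWLatticeVirasoro`, `SAWBetheAnsatz`): "the expression of the row transfer matrix as a product of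
local face operators generating a dilute Temperley–Lieb algebra `dTL_L(n)` … and the
logarithmic-derivative Hamiltonian `H_L` with its local densities `h_j`".

Sources read. A. Morin-Duchesne, A. Klümper, P. A. Pearce, J. Stat. Mech. (2023) 043103 =
arXiv:2211.12379 [`MorinDuchesneKlumperPearce2023`], §3.1 eq. (3.1) (the elementary face operator of
the dilute `A₂⁽²⁾` loop model "is defined as the linear combination of nine elementary tiles" with
weights `ρ₁ = s(2λ)s(3λ) + s(u)s(3λ−u)`, `ρ₂ = ρ₃ = s(2λ)s(3λ−u)`, `ρ₄ = ρ₅ = s(2λ)s(u)`,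
`ρ₆ = ρ₇ = s(u)s(3λ−u)`, `ρ₈ = s(2λ−u)s(3λ−u)`, `ρ₉ = −s(u)s(λ−u)`, `s(u) = sin u / sin λ`, loop weight
`β = −2 cos 4λ`) and §3.3 (action of diagrams on link states: "If two defects are connected or if a
loop segment is connected to a vacant site, the result is set to zero"; a closed loop gives `β`);
J. L. Jacobsen, LNP 775 (2009) [`Jacobsen2009`], §14.3.1 eq. (14.60) (the honeycomb `O(n)` loop
model `Z = Σ_G K^{|G|} n^{l(G)}`, after Nienhuis 1982, `x_c = 1/√(2+√(2−n))`). Context, not read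
here: B. Nienhuis, Int. J. Mod. Phys. B 4 (1990) 929 [`Nienhuis1990`] and Blöte–Nienhuis, J. Phys.
A 22 (1989) 1415 (square-lattice `O(n)` vertex weights, of which the honeycomb model is the case with
one two-strand vertex forbidden); W. M. Koo, H. Saleur, Nucl. Phys. B 426 (1994) 459
[`KooSaleur1994`], §3 (lattice Virasoro generators built from the local densities `h_j` of a
critical quantum chain `H = Σ h_j` — the use the requesting route makes of `hamDensity`).

## Contents (namespace `Literature.Probability.LatticeModels.DiluteTL`)

* `Tile` — the nine two-node dilute Temperley–Lieb diagrams (a basis of `dTL₂`), named by their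
  action from the bottom nodes `(a, b)` to the top nodes: `vac` (both vacant), `stayL`/`stayR` (one
  strand passes at `a` / at `b`), `cup` (an arc is created on `a, b`), `cap` (the strands at `a, b`
  are joined), `moveR`/`moveL` (the strand hops `a → b` / `b → a`), `id₂` (two strands pass), `tl`
  (the Temperley–Lieb generator `e`: join, then create). Their MDKP numbers `ρ₁,…,ρ₉` in this order
  are forced by `X(0) ∝ 1` (`ρ₄,…,ρ₇,ρ₉` vanish at `u = 0`, so `ρ₁, ρ₂, ρ₃, ρ₈` are the identity tiles)
  and by the crossing symmetry `u ↔ 3λ − u` (a quarter turn: `ρ₂,₃ ↔ ρ₄,₅`, `ρ₈ ↔ ρ₉`, `ρ₆,₇` fixed).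
* `tileAct` — the action of a tile at nodes `(a, b)` on a slot assignment (raw, `Option` = zero
  result, `Bool` = a loop was closed), with the MDKP rules; `tileMatrix β t a b` — its matrix on
  `DiluteLink N` (target, source), DECLARATIVELY: entry `β^{[loop]}` if the target's slots are the
  computed ones (outputs that are not planar link states match no target; they do not occur);
  `faceOp ρ β a b = Σ_t ρ t • tileMatrix β t a b`; `tileMatrix_id_sum`: the four identity tiles sum
  to `1`.
* `rho λ u : Tile → ℝ` (MDKP (3.1)), `loopWeight λ = −2 cos 4λ`, `a22FaceOp`; `a22FaceOp_zero`:
  `X(0) = s(2λ)s(3λ) • 1` (regularity); `faceWeight_eq_rho`: the `λ = π/3` weights of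
  `DiluteA22Weights.lean` are `(3/4)·rho (π/3) u`.
* `hexTileWeight x : Tile → R` — **the honeycomb `O(n)` vertex as a dilute tile**: contracting the
  rung `U_i — D_i` of a honeycomb column (see `HexONTransferMatrix.lean`) to a point gives a square
  vertex whose allowed local configurations are the tiles, with weight `x^{#honeycomb vertices
  visited}`: `(vac 1; stay x²; cup, cap x; move x²; id₂ 0 — both strands would need the rung; tl x²)`;
  `rho_two_mul_eq_hexTileWeight`: **`ρ_k(λ, u = 2λ) = 8 cos³λ · hexTileWeight (1/(2 cos λ)) k`** — the
  honeycomb model at `x = 1/(2 cos λ)`, `n = −2 cos 4λ` is the point `u = 2λ` of the integrable family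
  (`n = 0`: `λ = π/8`, `x = 1/√(2+√2) = hexCriticalFugacity`, `hexCriticalFugacity_eq`,
  `loopWeight_pi_div_eight`).
* `hamCoeff λ t = −∂_u ρ_t(λ, u)|_{u=0}`, `hamDensity λ a b = faceOp (hamCoeff λ) β a b = −X'(0)` (the
  local density `h_j`, up to the positive factor `1/(s(2λ)s(3λ))` and an additive constant), and the
  free-end bulk sum `hamiltonian λ n = Σ_{j<n} h_{j,j+1}` on `n + 1` nodes; `hamCoeff_eq`: the closed
  forms `−ρ'(0) = (−sin 3λ; sin 2λ cos 3λ ×2; −sin 2λ ×2; −sin 3λ ×2; sin 5λ; sin λ) / sin²λ`.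
* `tlGen_mul_self` (appendix): the Temperley–Lieb relation `e_{(a,b)}² = β e_{(a,b)}` for `a ≠ b`, from
  `tileAct_tl_of_arc` (on a state pairing `a` with `b` the generator closes one loop and recreates
  the arc).

## Not here / caveats

The dilute Temperley–Lieb relations (`e_j² = β e_j`, …) and the closure of planar link states under
the tiles are not proved (the declarative matrices make them statements about `tileAct`). The
factorisation of `HexON.transferMatrix` into these tiles (processing the column vertex pair
`U_i D_i` as the tile at nodes `(i, i+1)` of `T + 1` nodes, the extra node carrying the vertical rung
to the next pair; free ends = vacant extra node at the bottom, deleted at the top) is the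
Blöte–Nienhuis sparse-matrix form and is NOT proved here (it was checked outside Lean for `T ≤ 4`
as an identity of matrices of polynomials in `x, n`, with `tileAct` transcribed literally; the check
also confirms that the tiles map planar link states to planar link states there). No statement
relates the spectrum of
`hamiltonian` to that of the honeycomb transfer matrix (for free boundaries the commuting family is
Sklyanin's double-row matrix with boundary weights, MDKP (3.2)); that identification is part of the
physics input of items `KooSaleurVirasoro` / `ConformalTowers`, not of this file.
-/

noncomputable section

open Finset Matrix Real

namespace Literature.Probability.LatticeModels

namespace DiluteTL

/-! ### The nine tiles and their action on link states -/

/-- The nine two-node dilute Temperley–Lieb diagrams (tiles of the `A₂⁽²⁾` face operator), in the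
order `ρ₁, …, ρ₉` of MDKP (3.1), named by their action bottom `(a,b)` → top `(a,b)`.
[cite: MorinDuchesneKlumperPearce2023, §3.1 eq. (3.1)] -/
inductive Tile : Type
  | vac | stayL | stayR | cup | cap | moveR | moveL | id₂ | tl
  deriving DecidableEq

/-- The nine tiles, as an explicit finite type (listed in MDKP's order). [folklore] -/
instance Tile.instFintype : Fintype Tile where
  elems := {.vac, .stayL, .stayR, .cup, .cap, .moveR, .moveL, .id₂, .tl}
  complete t := by cases t <;> simp

variable {N : ℕ}

/-- Make the nodes `p` and `q` partners (raw slot assignment). [folklore] -/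
def relink (s : Fin N → LinkSlot N) (p q : Fin N) : Fin N → LinkSlot N :=
  Function.update (Function.update s p (.arc q)) q (.arc p)

/-- Move the content of node `a` to the (vacant) node `b`, redirecting the partner of `a` to `b`.
[cite: MorinDuchesneKlumperPearce2023, §3.3] -/
def moveRaw (s : Fin N → LinkSlot N) (a b : Fin N) : Fin N → LinkSlot N :=
  let s₁ := Function.update (Function.update s b (s a)) a .vac
  match s a with
  | .arc p => Function.update s₁ p (.arc b)
  | _ => s₁

/-- Join the strands at the occupied nodes `a, b` (which become vacant): two arc ends `a–p`, `b–q`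
give the arc `p–q`; an arc end and a defect make the far end a defect; the two ends of ONE arc
close a loop (flag `true`); two defects give zero (`none`); a vacancy gives zero.
[cite: MorinDuchesneKlumperPearce2023, §3.3 (action on link states)] -/
def capRaw (s : Fin N → LinkSlot N) (a b : Fin N) : Option ((Fin N → LinkSlot N) × Bool) :=
  let s₀ := Function.update (Function.update s a .vac) b .vac
  match s a, s b with
  | .arc p, .arc q =>
    if p = b then some (s₀, true)
    else some (Function.update (Function.update s₀ p (.arc q)) q (.arc p), false)
  | .arc p, .defect => some (Function.update s₀ p .defect, false)
  | .defect, .arc q => some (Function.update s₀ q .defect, false)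
  | _, _ => none

/-- **The action of a tile at the nodes `(a, b)`** on a slot assignment: `none` = zero (wrong
occupancy of the bottom nodes, or two defects joined), otherwise the new slots and whether a loop
was closed. [cite: MorinDuchesneKlumperPearce2023, §3.3 (action on link states)] -/
def tileAct (t : Tile) (s : Fin N → LinkSlot N) (a b : Fin N) : Option ((Fin N → LinkSlot N) × Bool) :=
  match t with
  | .vac => if s a = .vac ∧ s b = .vac then some (s, false) else none
  | .stayL => if s a ≠ .vac ∧ s b = .vac then some (s, false) else none
  | .stayR => if s a = .vac ∧ s b ≠ .vac then some (s, false) else none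
  | .cup => if s a = .vac ∧ s b = .vac then some (relink s a b, false) else none
  | .cap => capRaw s a b
  | .moveR => if s a ≠ .vac ∧ s b = .vac then some (moveRaw s a b, false) else none
  | .moveL => if s a = .vac ∧ s b ≠ .vac then some (moveRaw s b a, false) else none
  | .id₂ => if s a ≠ .vac ∧ s b ≠ .vac then some (s, false) else none
  | .tl => (capRaw s a b).map fun r => (relink r.1 a b, r.2)

section Ring

variable (R : Type*) [CommSemiring R]

/-- **The matrix of a tile** at nodes `(a, b)` with loop weight `β`, on planar dilute link states
(target `τ`, source `σ`): `β^{[a loop closed]}` if `τ` is the state computed by `tileAct`, else `0`.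
[cite: MorinDuchesneKlumperPearce2023, §3.3] -/
def tileMatrix (β : R) (t : Tile) (a b : Fin N) : Matrix (DiluteLink N) (DiluteLink N) R :=
  Matrix.of fun τ σ =>
    ((tileAct t σ.slot a b).map fun r => if τ.slot = r.1 then (if r.2 = true then β else (1 : R)) else 0).getD 0

/-- **The face operator with tile weights `ρ`** at nodes `(a, b)`: `Σ_t ρ_t · (tile t)`.
[cite: MorinDuchesneKlumperPearce2023, §3.1 eq. (3.1)] -/
def faceOp (ρ : Tile → R) (β : R) (a b : Fin N) : Matrix (DiluteLink N) (DiluteLink N) R :=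
  ∑ t : Tile, ρ t • tileMatrix R β t a b

/-- The dilute Temperley–Lieb generator `e` at nodes `(a, b)` (tile `tl`). [cite: MorinDuchesneKlumperPearce2023, §3.3] -/
def tlGen (β : R) (a b : Fin N) : Matrix (DiluteLink N) (DiluteLink N) R := tileMatrix R β .tl a b

variable {R}

/-- Unfolding `tileMatrix`. [folklore] -/
theorem tileMatrix_apply (β : R) (t : Tile) (a b : Fin N) (τ σ : DiluteLink N) :
    tileMatrix R β t a b τ σ = ((tileAct t σ.slot a b).map fun r =>
      if τ.slot = r.1 then (if r.2 = true then β else (1 : R)) else 0).getD 0 := rfl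

/-- **The identity tiles**: `vac + stayL + stayR + id₂ = 1` (exactly one occupancy pattern of the
bottom nodes applies and each of these tiles then acts identically). [cite: MorinDuchesneKlumperPearce2023, §3.1] -/
theorem tileMatrix_id_sum (β : R) (a b : Fin N) :
    tileMatrix R β .vac a b + tileMatrix R β .stayL a b + tileMatrix R β .stayR a b +
      tileMatrix R β .id₂ a b = 1 := by
  ext τ σ
  have hts : τ = σ ↔ τ.slot = σ.slot := ⟨fun h => h ▸ rfl, fun h => DiluteLink.ext h⟩
  simp only [Matrix.add_apply, Matrix.one_apply, tileMatrix_apply, tileAct, hts]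
  by_cases ha : σ.slot a = .vac <;> by_cases hb : σ.slot b = .vac <;> simp [ha, hb]

/-- Summation over the nine tiles, unfolded. [folklore] -/
theorem sum_tile {M : Type*} [AddCommMonoid M] (f : Tile → M) :
    ∑ t, f t = f .vac + f .stayL + f .stayR + f .cup + f .cap + f .moveR + f .moveL + f .id₂ + f .tl := by
  rw [show (univ : Finset Tile) = {.vac, .stayL, .stayR, .cup, .cap, .moveR, .moveL, .id₂, .tl} from rfl]
  simp only [mem_insert, reduceCtorEq, mem_singleton, or_self, not_false_eq_true, sum_insert,
    sum_singleton]
  abel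

end Ring

/-! ### The `A₂⁽²⁾` weights -/

/-- `s(u) = sin u / sin λ`. [cite: MorinDuchesneKlumperPearce2023, §3.1 eq. (3.1)] -/
def sfun (lam u : ℝ) : ℝ := sin u / sin lam

/-- **The nine local Boltzmann weights `ρ₁(u), …, ρ₉(u)` of the dilute `A₂⁽²⁾` loop model** with
crossing parameter `λ` and spectral parameter `u`. [cite: MorinDuchesneKlumperPearce2023, §3.1 eq. (3.1)] -/
def rho (lam u : ℝ) : Tile → ℝ
  | .vac => sfun lam (2 * lam) * sfun lam (3 * lam) + sfun lam u * sfun lam (3 * lam - u)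
  | .stayL => sfun lam (2 * lam) * sfun lam (3 * lam - u)
  | .stayR => sfun lam (2 * lam) * sfun lam (3 * lam - u)
  | .cup => sfun lam (2 * lam) * sfun lam u
  | .cap => sfun lam (2 * lam) * sfun lam u
  | .moveR => sfun lam u * sfun lam (3 * lam - u)
  | .moveL => sfun lam u * sfun lam (3 * lam - u)
  | .id₂ => sfun lam (2 * lam - u) * sfun lam (3 * lam - u)
  | .tl => -(sfun lam u * sfun lam (lam - u))

/-- The weight `β = −2 cos 4λ` of (contractible) loops. [cite: MorinDuchesneKlumperPearce2023, §3.1] -/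
def loopWeight (lam : ℝ) : ℝ := -2 * cos (4 * lam)

/-- **The `A₂⁽²⁾` face operator `X_{(a,b)}(u)`** on dilute link states. [cite: MorinDuchesneKlumperPearce2023, §3.1 eq. (3.1)] -/
def a22FaceOp (lam u : ℝ) (a b : Fin N) : Matrix (DiluteLink N) (DiluteLink N) ℝ :=
  faceOp ℝ (rho lam u) (loopWeight lam) a b

/-- The weights at `u = 0`: only the identity tiles survive, each with weight `s(2λ)s(3λ)`.
[cite: MorinDuchesneKlumperPearce2023, §3.1] -/
theorem rho_zero (lam : ℝ) (t : Tile) :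
    rho lam 0 t = if t = .vac ∨ t = .stayL ∨ t = .stayR ∨ t = .id₂ then
      sfun lam (2 * lam) * sfun lam (3 * lam) else 0 := by
  cases t <;> simp [rho, sfun]

/-- **Regularity**: at `u = 0` the face operator is `s(2λ)s(3λ)` times the identity.
[cite: MorinDuchesneKlumperPearce2023, §3.1] -/
theorem a22FaceOp_zero (lam : ℝ) (a b : Fin N) :
    a22FaceOp lam 0 a b = (sfun lam (2 * lam) * sfun lam (3 * lam)) • (1 : Matrix _ _ ℝ) := by
  rw [← tileMatrix_id_sum (R := ℝ) (loopWeight lam) a b, a22FaceOp, faceOp, sum_tile]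
  simp only [rho, sfun, sin_zero, zero_div, zero_mul, mul_zero, neg_zero, zero_smul, add_zero,
    sub_zero, smul_add]

/-- The MDKP number (minus one) of a tile: `vac ↦ 0, …, tl ↦ 8`, indexing `ρ₁, …, ρ₉` and the
vector `DiluteA22.faceWeight u : Fin 9 → ℝ`. [cite: MorinDuchesneKlumperPearce2023, §3.1 eq. (3.1)] -/
def Tile.idx : Tile → Fin 9
  | .vac => 0 | .stayL => 1 | .stayR => 2 | .cup => 3 | .cap => 4
  | .moveR => 5 | .moveL => 6 | .id₂ => 7 | .tl => 8

/-- **Consistency with `DiluteA22Weights.lean`**: at the percolation point `λ = π/3` the weights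
`DiluteA22.faceWeight u` (normalised there by the factor `sin²(π/3) = 3/4`) are `(3/4) · rho (π/3) u`,
tile by tile in MDKP's order. [cite: MorinDuchesneKlumperPearce2023, §3.1 eq. (3.1) at λ = π/3] -/
theorem faceWeight_eq_rho (u : ℝ) (t : Tile) :
    DiluteA22.faceWeight u t.idx = 3 / 4 * rho (π / 3) u t := by
  have h3 : Real.sqrt 3 ^ 2 = 3 := Real.sq_sqrt (by norm_num)
  have key : ∀ a b : ℝ, 3 / 4 * (a / sin (π / 3) * (b / sin (π / 3))) = a * b := by
    intro a b
    rw [sin_pi_div_three]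
    have : Real.sqrt 3 ≠ 0 := by positivity
    field_simp
    rw [h3]
    ring
  have hs2 : sin (2 * (π / 3)) = Real.sqrt 3 / 2 := by
    rw [show 2 * (π / 3) = π - π / 3 by ring, sin_pi_sub, sin_pi_div_three]
  have hs3 : sin (3 * (π / 3)) = 0 := by rw [show 3 * (π / 3) = π by ring, sin_pi]
  have hsu : sin (3 * (π / 3) - u) = sin u := by rw [show 3 * (π / 3) - u = π - u by ring, sin_pi_sub]
  have hid : sin (2 * (π / 3) - u) = sin (2 * π / 3 - u) := by congr 1; ring
  have htl : sin (π / 3 - u) = -sin (u - π / 3) := by rw [← sin_neg]; congr 1; ring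
  cases t <;>
    simp only [Tile.idx, DiluteA22.faceWeight_zero, DiluteA22.faceWeight_one,
      DiluteA22.faceWeight_two, DiluteA22.faceWeight_three, DiluteA22.faceWeight_four,
      DiluteA22.faceWeight_five, DiluteA22.faceWeight_six, DiluteA22.faceWeight_seven,
      DiluteA22.faceWeight_eight, rho, sfun, hs2, hs3, hsu, hid, htl, zero_div, mul_zero,
      zero_add, mul_neg, neg_neg, key] <;>
    ring

/-! ### The honeycomb `O(n)` vertex as a dilute tile -/

section Hex

variable (R : Type*) [CommSemiring R]

/-- **The honeycomb vertex pair as a dilute tile.** Contract the rung `U — D` of a honeycomb column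
(`HexONTransferMatrix.lean`: `U` carries the in-port and the edge from below, `D` the out-port and
the edge upwards) to one square vertex; a loop configuration visits `U`, `D`, both or neither, and
the weight `x^{#visited vertices}` of each two-node tile is: `vac ↦ 1`; `stayL, stayR ↦ x²` (the
strand turns through the rung); `cup, cap ↦ x` (one vertex); `moveR, moveL ↦ x²` (straight through the
rung); `id₂ ↦ 0` (both strands would need the rung); `tl ↦ x²` (cap at `U` and cup at `D`). These are
the honeycomb `O(n)` weights (`x` per visited vertex — Duminil-Copin–Smirnov's `x^{ℓ}`, Nienhuis'
`K` per edge for closed loops — and `n` per loop, Jacobsen (14.60)) read locally.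
[cite: Jacobsen2009, §14.3.1 eq. (14.60); DuminilCopinSmirnov2012, §1] -/
def hexTileWeight (x : R) : Tile → R
  | .vac => 1
  | .stayL => x ^ 2
  | .stayR => x ^ 2
  | .cup => x
  | .cap => x
  | .moveR => x ^ 2
  | .moveL => x ^ 2
  | .id₂ => 0
  | .tl => x ^ 2

/-- The honeycomb face operator at nodes `(a, b)`: `Σ_t hexTileWeight x t · tile t` with loop weight
`n`. [cite: Jacobsen2009, §14.3.1 eq. (14.60)] -/
def hexFaceOp (n x : R) (a b : Fin N) : Matrix (DiluteLink N) (DiluteLink N) R :=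
  faceOp R (hexTileWeight R x) n a b

end Hex

/-- **The honeycomb point of the integrable `A₂⁽²⁾` family**: at `u = 2λ` the nine weights are
`8 cos³λ` times the honeycomb tile weights at `x = 1/(2 cos λ)` (so, with `n = β = −2 cos 4λ`,
Nienhuis' critical honeycomb `O(n)` model, `x = x_c(n) = 1/√(2+√(2−n))` on the branch
`0 < λ ≤ π/4`, is a specialisation of the Yang–Baxter integrable face weights — the square-lattice
`O(n)` vertex model of Nienhuis 1990 / Blöte–Nienhuis 1989 with one two-strand vertex of weight zero;
`id₂` drops out since `ρ₈(2λ) = s(0)s(λ) = 0`). A computation from MDKP (3.1); requires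
`sin λ ≠ 0` (for `s`) and `cos λ ≠ 0`. [cite: MorinDuchesneKlumperPearce2023, §3.1 eq. (3.1) at u = 2λ] -/
theorem rho_two_mul_eq_hexTileWeight {lam : ℝ} (hs : sin lam ≠ 0) (hc : cos lam ≠ 0) (t : Tile) :
    rho lam (2 * lam) t = 8 * cos lam ^ 3 * hexTileWeight ℝ (1 / (2 * cos lam)) t := by
  have e1 : 3 * lam - 2 * lam = lam := by ring
  have e2 : 2 * lam - 2 * lam = 0 := by ring
  have e3 : lam - 2 * lam = -lam := by ring
  have h2 : sin (2 * lam) = 2 * sin lam * cos lam := sin_two_mul lam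
  have h3 : sin (3 * lam) = 3 * sin lam - 4 * sin lam ^ 3 := sin_three_mul lam
  have hp : sin lam ^ 2 + cos lam ^ 2 = 1 := sin_sq_add_cos_sq lam
  cases t <;> simp only [rho, sfun, hexTileWeight, e1, e2, e3, h2, h3, sin_zero, sin_neg] <;>
    field_simp <;> nlinarith [hp]

/-- At `λ = π/8` the loop weight vanishes: `n = −2 cos(π/2) = 0` (self-avoiding walks / polymers).
[cite: MorinDuchesneKlumperPearce2023, §3.1 (β = −2 cos 4λ)] -/
theorem loopWeight_pi_div_eight : loopWeight (π / 8) = 0 := by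
  rw [loopWeight, show 4 * (π / 8) = π / 2 by ring, cos_pi_div_two, mul_zero]

/-- At `λ = π/8` the honeycomb fugacity `1/(2 cos λ)` is the critical fugacity `1/√(2+√2)` of
Duminil-Copin–Smirnov (`hexCriticalFugacity`). [cite: DuminilCopinSmirnov2012, Thm 1] -/
theorem hexCriticalFugacity_eq :
    Literature.Probability.RandomPlanarGeometry.SAW.hexCriticalFugacity = 1 / (2 * cos (π / 8)) := by
  rw [Literature.Probability.RandomPlanarGeometry.SAW.hexCriticalFugacity, cos_pi_div_eight]
  field_simp

/-! ### Hamiltonian densities -/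

/-- The coefficient of the tile `t` in the Hamiltonian density: `−∂_u ρ_t(λ, u)` at `u = 0`
(logarithmic derivative of the face operator at the regular point `X(0) ∝ 1`; overall positive
normalisation `1/(s(2λ)s(3λ))` and additive constants are left to the user).
[cite: MorinDuchesneKlumperPearce2023, §3.1 eq. (3.1) (differentiated at u = 0)] -/
def hamCoeff (lam : ℝ) (t : Tile) : ℝ := -deriv (fun u => rho lam u t) 0

/-- **The local Hamiltonian density `h_{(a,b)} = −X'_{(a,b)}(0)`** of the dilute `A₂⁽²⁾` chain on
dilute link states, at nodes `(a, b)`. [cite: MorinDuchesneKlumperPearce2023, §3.1 eq. (3.1) (differentiated at u = 0)] -/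
def hamDensity (lam : ℝ) (a b : Fin N) : Matrix (DiluteLink N) (DiluteLink N) ℝ :=
  faceOp ℝ (hamCoeff lam) (loopWeight lam) a b

/-- **The bulk Hamiltonian with free ends** on `n + 1` nodes: `H = Σ_{j < n} h_{(j, j+1)}` (no boundary
terms; the nearest-neighbour sum of the local densities). [folklore] -/
def hamiltonian (lam : ℝ) (n : ℕ) : Matrix (DiluteLink (n + 1)) (DiluteLink (n + 1)) ℝ :=
  ∑ j : Fin n, hamDensity lam (Fin.castSucc j) j.succ

/-- The Hamiltonian density is the face operator with the derivative coefficients (definitional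
unfolding, recorded for users). [folklore] -/
theorem hamDensity_eq (lam : ℝ) (a b : Fin N) :
    hamDensity lam a b = ∑ t : Tile, (-deriv (fun u => rho lam u t) 0) • tileMatrix ℝ (loopWeight lam) t a b :=
  rfl

/-- **The Hamiltonian coefficients in closed form**: `−ρ'_t(0)` equals `−sin 3λ / sin²λ` (`vac`,
`moveR`, `moveL`), `sin 2λ cos 3λ / sin²λ` (`stayL`, `stayR`), `−sin 2λ / sin²λ` (`cup`, `cap`),
`sin 5λ / sin²λ` (`id₂`) and `1 / sin λ` (`tl`), for `sin λ ≠ 0`. [cite: MorinDuchesneKlumperPearce2023, §3.1 eq. (3.1) (differentiated at u = 0)] -/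
theorem hamCoeff_eq {lam : ℝ} (hlam : sin lam ≠ 0) (t : Tile) :
    hamCoeff lam t = match t with
      | .vac => -(sin (3 * lam) / sin lam ^ 2)
      | .stayL => sin (2 * lam) * cos (3 * lam) / sin lam ^ 2
      | .stayR => sin (2 * lam) * cos (3 * lam) / sin lam ^ 2
      | .cup => -(sin (2 * lam) / sin lam ^ 2)
      | .cap => -(sin (2 * lam) / sin lam ^ 2)
      | .moveR => -(sin (3 * lam) / sin lam ^ 2)
      | .moveL => -(sin (3 * lam) / sin lam ^ 2)
      | .id₂ => sin (5 * lam) / sin lam ^ 2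
      | .tl => 1 / sin lam := by
  -- derivatives of the building blocks at `u = 0`
  have hs : ∀ c : ℝ, HasDerivAt (fun u => sin (c - u) / sin lam) (-cos c / sin lam) 0 := by
    intro c
    have h := ((hasDerivAt_id (0 : ℝ)).const_sub c).sin.div_const (sin lam)
    simpa using h
  have h0 : HasDerivAt (fun u => sin u / sin lam) (1 / sin lam) 0 := by
    simpa using (hasDerivAt_sin 0).div_const (sin lam)
  have e5 : sin (5 * lam) = sin (2 * lam) * cos (3 * lam) + cos (2 * lam) * sin (3 * lam) := by
    rw [show 5 * lam = 2 * lam + 3 * lam by ring, sin_add]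
  have hmove : HasDerivAt (fun u => sin u / sin lam * (sin (3 * lam - u) / sin lam))
      (1 / sin lam * (sin (3 * lam - 0) / sin lam) + sin 0 / sin lam * (-cos (3 * lam) / sin lam)) 0 :=
    h0.fun_mul (hs (3 * lam))
  cases t <;> simp only [hamCoeff, rho, sfun]
  · rw [(hmove.const_add (sin (2 * lam) / sin lam * (sin (3 * lam) / sin lam))).deriv]
    simp only [sub_zero, sin_zero, zero_div, zero_mul, add_zero]
    ring
  · rw [((hs (3 * lam)).const_mul (sin (2 * lam) / sin lam)).deriv]
    ring
  · rw [((hs (3 * lam)).const_mul (sin (2 * lam) / sin lam)).deriv]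
    ring
  · rw [(h0.const_mul (sin (2 * lam) / sin lam)).deriv]
    ring
  · rw [(h0.const_mul (sin (2 * lam) / sin lam)).deriv]
    ring
  · rw [hmove.deriv]
    simp only [sub_zero, sin_zero, zero_div, zero_mul, add_zero]
    ring
  · rw [hmove.deriv]
    simp only [sub_zero, sin_zero, zero_div, zero_mul, add_zero]
    ring
  · have h := ((hs (2 * lam)).fun_mul (hs (3 * lam))).deriv
    rw [h, e5]
    simp only [sub_zero]
    ring
  · have h := ((h0.fun_mul (hs lam)).fun_neg).deriv
    rw [h]
    simp only [sub_zero, sin_zero, zero_div, zero_mul, add_zero]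
    field_simp

end DiluteTL

end Literature.Probability.LatticeModels

end
namespace Literature.Probability.LatticeModels

namespace DiluteTL

/-! ### The Temperley–Lieb relation `e² = β e` for the generator tile -/

variable {N : ℕ}

/-- `relink s a b` pairs `a` with `b`: the slot of `a`. [folklore] -/
theorem relink_apply_left (s : Fin N → LinkSlot N) {a b : Fin N} (hab : a ≠ b) :
    relink s a b a = .arc b := by
  simp [relink, Function.update_of_ne hab]

/-- `relink s a b` pairs `a` with `b`: the slot of `b`. [folklore] -/
theorem relink_apply_right (s : Fin N → LinkSlot N) (a b : Fin N) : relink s a b b = .arc a := by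
  simp [relink]

/-- Emptying the two ends of the arc `a — b` and re-pairing them gives the state back. [folklore] -/
theorem relink_erase_arc {s : Fin N → LinkSlot N} {a b : Fin N} (ha : s a = .arc b) (hb : s b = .arc a) :
    relink (Function.update (Function.update s a .vac) b .vac) a b = s := by
  funext k
  by_cases hkb : k = b
  · subst hkb; simp [relink, hb]
  · by_cases hka : k = a
    · subst hka; simp [relink, Function.update_of_ne hkb, ha]
    · simp [relink, Function.update_of_ne hkb, Function.update_of_ne hka]

/-- Joining the two ends of one arc `a — b` closes a loop and empties both nodes. [cite: MorinDuchesneKlumperPearce2023, §3.3 (action on link states)] -/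
theorem capRaw_arc_self {s : Fin N → LinkSlot N} {a b : Fin N} (ha : s a = .arc b) (hb : s b = .arc a) :
    capRaw s a b = some (Function.update (Function.update s a .vac) b .vac, true) := by
  simp only [capRaw, ha, hb, if_true]

/-- The generator tile on a state pairing `a` with `b`: the loop is closed and the arc re-created,
so the state is unchanged and one loop is counted. [cite: MorinDuchesneKlumperPearce2023, §3.3 (action on link states)] -/
theorem tileAct_tl_of_arc {s : Fin N → LinkSlot N} {a b : Fin N} (ha : s a = .arc b) (hb : s b = .arc a) :
    tileAct .tl s a b = some (s, true) := by
  simp only [tileAct, capRaw_arc_self ha hb, Option.map_some, relink_erase_arc ha hb]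

/-- Any output of the generator tile pairs `a` with `b`. [folklore] -/
theorem tileAct_tl_eq_some {s s' : Fin N → LinkSlot N} {a b : Fin N} {f : Bool} (hab : a ≠ b)
    (h : tileAct .tl s a b = some (s', f)) : s' a = .arc b ∧ s' b = .arc a := by
  simp only [tileAct] at h
  obtain ⟨r, -, hr⟩ := Option.map_eq_some_iff.1 h
  simp only [Prod.mk.injEq] at hr
  rw [← hr.1]
  exact ⟨relink_apply_left _ hab, relink_apply_right _ _ _⟩

/-- **The Temperley–Lieb relation for the generator tile**: at two distinct nodes `a ≠ b`,
`e_{(a,b)}² = β · e_{(a,b)}` on dilute link states (the second `e` closes the arc created by the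
first: one loop, weight `β`). [cite: MorinDuchesneKlumperPearce2023, §3.3] -/
theorem tlGen_mul_self {R : Type*} [CommSemiring R] (β : R) {a b : Fin N} (hab : a ≠ b) :
    tlGen R β a b * tlGen R β a b = β • tlGen R β a b := by
  ext τ σ
  rw [Matrix.mul_apply, Matrix.smul_apply, smul_eq_mul]
  simp only [tlGen, tileMatrix_apply]
  rcases h : tileAct .tl σ.slot a b with _ | ⟨s', f⟩
  · simp
  · simp only [Option.map_some, Option.getD_some]
    have hs' := tileAct_tl_eq_some hab h
    have hμ : ∀ μ : DiluteLink N, μ.slot = s' → tileAct .tl μ.slot a b = some (μ.slot, true) :=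
      fun μ hμ => tileAct_tl_of_arc (hμ ▸ hs'.1) (hμ ▸ hs'.2)
    have hdiag : ∀ μ : DiluteLink N, μ.slot = s' → μ ≠ τ →
        ((tileAct .tl μ.slot a b).map fun r =>
          if τ.slot = r.1 then (if r.2 = true then β else (1 : R)) else 0).getD 0 = 0 := by
      intro μ hμs hμτ
      rw [hμ μ hμs]
      simp only [Option.map_some, Option.getD_some]
      rw [if_neg]
      exact fun hτμ => hμτ (DiluteLink.ext hτμ).symm
    by_cases hτ : τ.slot = s'
    · rw [if_pos hτ, Finset.sum_eq_single τ]
      · rw [hμ τ hτ, if_pos hτ]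
        simp
      · intro μ _ hμτ
        by_cases hμs : μ.slot = s'
        · rw [hdiag μ hμs hμτ, zero_mul]
        · rw [if_neg hμs, mul_zero]
      · simp
    · rw [if_neg hτ, mul_zero]
      refine Finset.sum_eq_zero fun μ _ => ?_
      by_cases hμs : μ.slot = s'
      · rw [hdiag μ hμs (fun h => hτ (h ▸ hμs)), zero_mul]
      · rw [if_neg hμs, mul_zero]

end DiluteTL

end Literature.Probability.LatticeModels
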